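import Mathlib
import HarnessLib
import Summits.Ventures.LatticeQCDFlow.Scaling.Bhattacharyya

/-!
# LatticeQCDFlow / Scaling — the midpoint-law Jensen floor on a FINITE space:
# `BC(p,q)²·e^{−σ/√2} ≤ accRate p q ≤ BC(p,q)²`

HONEST FRAMING: exact (Metropolis-corrected) sampling algorithms for lattice gauge theory;
figures of merit are autocorrelation/cost numbers at stated couplings and volumes; no
continuum-physics claim.

Venture `LatticeQCDFlow` (cell pub-lqcd), topic `Scaling`; FANOUT row 3 (`s0-u1-a`, S0-B
implementation A, GEN-15).  NEW WORK of the cell (elementary finite sums), not a published result;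
NO definition is introduced.  Row 31's finite `Scaling/Bhattacharyya` (imported) has the CEILING
`accRate p q ≤ bhatt p q ²` (T2-M) for the stationary acceptance
`accRate p q = Σ_x Σ_y min(p_x q_y, p_y q_x)` of the flow (independence) sampler on a `Fintype`;
this file is the finite twin of row 3's general-space `Scaling/AcceptanceMidpointLaw` (GEN-15): the
acceptance is the squared Bhattacharyya coefficient times the mean of `e^{−|log w_x − log w_y|/2}`
under the MIDPOINT LAW `ρ_x = √(p_x q_x)/BC` on pairs, hence a FLOOR by Jensen.  With
`k_x = √(p_x q_x)`, `ℓ_x = log(p_x/q_x)`, `BC = bhatt p q = Σ k`: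

* **`accRate_eq_sum_midpointKernel`** — `accRate p q = Σ_x Σ_y k_x k_y e^{−|ℓ_x − ℓ_y|/2}`;
* **`bhatt_sq_mul_exp_le_accRate`** — `BC²·exp(−(Σ_x Σ_y k_x k_y |ℓ_x − ℓ_y|)/(2BC²)) ≤ accRate p q`
  (tangent-line Jensen for `exp` under the pair weights `k_x k_y`);
* **`bhatt_sq_mul_exp_sqrt_le_accRate`** — for any centring constant `c`, with
  `γ_c = Σ_x k_x (ℓ_x − c)²`: `BC²·exp(−√(γ_c/(2BC))) ≤ accRate p q` (Cauchy–Schwarz on pairs and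
  the pair-variance identity `Σ_x Σ_y k_x k_y (ℓ_x − ℓ_y)² = 2BC·γ_c − 2(Σ k(ℓ − c))²`), i.e.
  `accRate ≥ BC²·e^{−σ/√2}` with `σ²` the midpoint-law variance of the log weight;
* **`bhatt_sq_mul_exp_le_accRate_of_abs_le`** — `|ℓ_x − c| ≤ R` wherever `p_x q_x > 0` ⇒
  `BC²·e^{−R/√2} ≤ accRate p q`.

Reading (value-free): on a finite configuration space the Bhattacharyya ceiling of the stationary
acceptance is missed by at most the factor `e^{−σ/√2}`; the `m`-block rate statements are in the
general-space files (`Scaling/AcceptanceVolumeRatePi`, `…RateUniversal`).  NOT CLAIMED: any value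
of ours; nothing re-scored.
-/

namespace Summit.Ventures.LatticeQCDFlow.Theory2

open Finset
open Summit.Ventures.LatticeQCDFlow.Exactness

variable {X : Type*} [Fintype X]

/-- **THE MIDPOINT IDENTITY (finite).**  For `p, q ≥ 0`:
`accRate p q = Σ_x Σ_y √(p_x q_x) √(p_y q_y) e^{−|log(p_x/q_x) − log(p_y/q_y)|/2}`. [ours] -/
theorem accRate_eq_sum_midpointKernel {p q : X → ℝ} (hp : ∀ x, 0 ≤ p x) (hq : ∀ x, 0 ≤ q x) :
    accRate p q = ∑ x, ∑ y, Real.sqrt (p x * q x) * Real.sqrt (p y * q y)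
      * Real.exp (-|Real.log (p x / q x) - Real.log (p y / q y)| / 2) := by
  -- positive case of the pointwise identity
  have hpos : ∀ {u v : ℝ}, 0 < u → 0 < v → u ≤ v →
      min u v = Real.sqrt (u * v) * Real.exp (-|Real.log u - Real.log v| / 2) := by
    intro u v hu hv huv
    rw [min_eq_left huv, abs_of_nonpos (by linarith [Real.log_le_log hu huv]), neg_neg,
      show (Real.log u - Real.log v) / 2 = Real.log u * (1 / 2) - Real.log v * (1 / 2) by ring,
      Real.exp_sub, ← Real.rpow_def_of_pos hu, ← Real.rpow_def_of_pos hv, ← Real.sqrt_eq_rpow,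
      ← Real.sqrt_eq_rpow, Real.sqrt_mul hu.le]
    have hsv : Real.sqrt v ≠ 0 := (Real.sqrt_pos.2 hv).ne'
    field_simp
    rw [Real.sq_sqrt hu.le]
  have hpos' : ∀ {u v : ℝ}, 0 < u → 0 < v →
      min u v = Real.sqrt (u * v) * Real.exp (-|Real.log u - Real.log v| / 2) := by
    intro u v hu hv
    rcases le_total u v with h | h
    · exact hpos hu hv h
    · rw [min_comm, mul_comm u v, abs_sub_comm]; exact hpos hv hu h
  unfold accRate
  refine sum_congr rfl fun a _ => sum_congr rfl fun b _ => ?_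
  rcases (hp a).eq_or_lt with hpa | hpa
  · rw [← hpa, zero_mul, zero_mul, Real.sqrt_zero, zero_mul, zero_mul]
    exact min_eq_left (mul_nonneg (hp b) (hq a))
  rcases (hq a).eq_or_lt with hqa | hqa
  · rw [← hqa, mul_zero, mul_zero, Real.sqrt_zero, zero_mul, zero_mul]
    exact min_eq_right (mul_nonneg (hp a) (hq b))
  rcases (hp b).eq_or_lt with hpb | hpb
  · rw [← hpb, zero_mul, zero_mul, Real.sqrt_zero, mul_zero, zero_mul]
    exact min_eq_right (mul_nonneg (hp a) (hq b))
  rcases (hq b).eq_or_lt with hqb | hqb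
  · rw [← hqb, mul_zero, mul_zero, Real.sqrt_zero, mul_zero, zero_mul]
    exact min_eq_left (mul_nonneg (hp b) (hq a))
  rw [hpos' (mul_pos hpa hqb) (mul_pos hpb hqa), Real.log_mul hpa.ne' hqb.ne',
    Real.log_mul hpb.ne' hqa.ne', Real.log_div hpa.ne' hqa.ne', Real.log_div hpb.ne' hqb.ne',
    ← Real.sqrt_mul (mul_nonneg hpa.le hqa.le)]
  congr 2
  · ring
  · congr 3
    ring

/-- `bhatt p q ² = Σ_x Σ_y k_x k_y`. [folklore] -/
theorem bhatt_sq_eq_sum (p q : X → ℝ) :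
    bhatt p q ^ 2 = ∑ x, ∑ y, Real.sqrt (p x * q x) * Real.sqrt (p y * q y) := by
  unfold bhatt
  rw [sq, sum_mul_sum]

/-- **THE JENSEN FLOOR (finite, mean absolute log-weight gap).**  For `p, q ≥ 0` with
`BC = bhatt p q > 0`:
`BC²·exp(−(Σ_x Σ_y k_x k_y |ℓ_x − ℓ_y|)/(2·BC²)) ≤ accRate p q`. [ours] -/
theorem bhatt_sq_mul_exp_le_accRate {p q : X → ℝ} (hp : ∀ x, 0 ≤ p x) (hq : ∀ x, 0 ≤ q x)
    (hB : 0 < bhatt p q) :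
    bhatt p q ^ 2 * Real.exp (-(∑ x, ∑ y, Real.sqrt (p x * q x) * Real.sqrt (p y * q y)
        * |Real.log (p x / q x) - Real.log (p y / q y)|) / (2 * bhatt p q ^ 2))
      ≤ accRate p q := by
  set I := ∑ x, ∑ y, Real.sqrt (p x * q x) * Real.sqrt (p y * q y)
    * |Real.log (p x / q x) - Real.log (p y / q y)| with hI
  set Z := bhatt p q ^ 2 with hZdef
  set c := -I / (2 * Z) with hc
  have hZ : 0 < Z := pow_pos hB 2
  have hk0 : ∀ x, 0 ≤ Real.sqrt (p x * q x) := fun x => Real.sqrt_nonneg _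
  -- termwise tangent line `K e^{F} ≥ e^c (1 − c) K + e^c K F`, `F = −|ℓ_x − ℓ_y|/2`
  have hpt : ∀ x y, Real.exp c * (1 - c) * (Real.sqrt (p x * q x) * Real.sqrt (p y * q y))
      + Real.exp c * (-(1 / 2)) * (Real.sqrt (p x * q x) * Real.sqrt (p y * q y)
        * |Real.log (p x / q x) - Real.log (p y / q y)|)
      ≤ Real.sqrt (p x * q x) * Real.sqrt (p y * q y)
        * Real.exp (-|Real.log (p x / q x) - Real.log (p y / q y)| / 2) := by
    intro x y
    have h := Real.add_one_le_exp (-|Real.log (p x / q x) - Real.log (p y / q y)| / 2 - c)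
    have h' : Real.exp c * (1 + (-|Real.log (p x / q x) - Real.log (p y / q y)| / 2 - c))
        ≤ Real.exp (-|Real.log (p x / q x) - Real.log (p y / q y)| / 2) := by
      calc Real.exp c * (1 + (-|Real.log (p x / q x) - Real.log (p y / q y)| / 2 - c))
          ≤ Real.exp c * Real.exp (-|Real.log (p x / q x) - Real.log (p y / q y)| / 2 - c) :=
            mul_le_mul_of_nonneg_left (by linarith) (Real.exp_nonneg _)
        _ = Real.exp (-|Real.log (p x / q x) - Real.log (p y / q y)| / 2) := by
            rw [← Real.exp_add]; ring_nf
    have := mul_le_mul_of_nonneg_left h' (mul_nonneg (hk0 x) (hk0 y))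
    have key : Real.sqrt (p x * q x) * Real.sqrt (p y * q y)
        * (Real.exp c * (1 + (-|Real.log (p x / q x) - Real.log (p y / q y)| / 2 - c)))
        = Real.exp c * (1 - c) * (Real.sqrt (p x * q x) * Real.sqrt (p y * q y))
          + Real.exp c * (-(1 / 2)) * (Real.sqrt (p x * q x) * Real.sqrt (p y * q y)
            * |Real.log (p x / q x) - Real.log (p y / q y)|) := by ring
    linarith [this, key]
  have hsum := sum_le_sum fun x (_ : x ∈ univ) => sum_le_sum fun y (_ : y ∈ univ) => hpt x y
  rw [accRate_eq_sum_midpointKernel hp hq]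
  refine le_trans (le_of_eq ?_) hsum
  simp_rw [sum_add_distrib, ← mul_sum, ← sum_mul]
  have hZ' : (∑ x, Real.sqrt (p x * q x)) * ∑ x, Real.sqrt (p x * q x) = Z := by
    rw [hZdef, bhatt, sq]
  rw [hZ', ← hI]
  have hIc : I = -2 * Z * c := by rw [hc]; field_simp
  rw [hIc]
  ring

/-- **THE JENSEN FLOOR, SECOND-MOMENT FORM (finite).**  For `p, q ≥ 0` with `BC = bhatt p q > 0` and
any centring constant `c`, with `γ_c = Σ_x √(p_x q_x)(log(p_x/q_x) − c)²`:
`BC²·exp(−√(γ_c/(2·BC))) ≤ accRate p q` — `accRate ≥ BC²·e^{−σ/√2}`. [ours] -/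
theorem bhatt_sq_mul_exp_sqrt_le_accRate {p q : X → ℝ} (hp : ∀ x, 0 ≤ p x) (hq : ∀ x, 0 ≤ q x)
    (hB : 0 < bhatt p q) (c : ℝ) :
    bhatt p q ^ 2 * Real.exp (-Real.sqrt ((∑ x, Real.sqrt (p x * q x) * (Real.log (p x / q x) - c) ^ 2)
        / (2 * bhatt p q)))
      ≤ accRate p q := by
  have hk0 : ∀ x, 0 ≤ Real.sqrt (p x * q x) := fun x => Real.sqrt_nonneg _
  have hγ0 : 0 ≤ ∑ x, Real.sqrt (p x * q x) * (Real.log (p x / q x) - c) ^ 2 :=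
    sum_nonneg fun x _ => mul_nonneg (hk0 x) (sq_nonneg _)
  -- the pair sums on `X × X`
  set I := ∑ z : X × X, Real.sqrt (p z.1 * q z.1) * Real.sqrt (p z.2 * q z.2)
    * |Real.log (p z.1 / q z.1) - Real.log (p z.2 / q z.2)| with hI
  have hI0 : 0 ≤ I := sum_nonneg fun z _ => mul_nonneg (mul_nonneg (hk0 _) (hk0 _)) (abs_nonneg _)
  have hIxy : ∑ x, ∑ y, Real.sqrt (p x * q x) * Real.sqrt (p y * q y)
      * |Real.log (p x / q x) - Real.log (p y / q y)| = I := by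
    rw [hI, Fintype.sum_prod_type]
  -- Cauchy–Schwarz on pairs
  have hCS : I ^ 2 ≤ (∑ z : X × X, Real.sqrt (p z.1 * q z.1) * Real.sqrt (p z.2 * q z.2))
      * ∑ z : X × X, Real.sqrt (p z.1 * q z.1) * Real.sqrt (p z.2 * q z.2)
        * (Real.log (p z.1 / q z.1) - Real.log (p z.2 / q z.2)) ^ 2 :=
    sum_sq_le_sum_mul_sum_of_sq_le_mul univ (fun z _ => mul_nonneg (hk0 _) (hk0 _))
      (fun z _ => mul_nonneg (mul_nonneg (hk0 _) (hk0 _)) (sq_nonneg _))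
      fun z _ => le_of_eq (by rw [mul_pow, sq_abs]; ring)
  have hZ : ∑ z : X × X, Real.sqrt (p z.1 * q z.1) * Real.sqrt (p z.2 * q z.2) = bhatt p q ^ 2 := by
    rw [Fintype.sum_prod_type, bhatt_sq_eq_sum]
  -- the pair variance: `ΣΣ k k (ℓ_x − ℓ_y)² = 2·BC·γ − 2·α²`
  have hV : ∑ z : X × X, Real.sqrt (p z.1 * q z.1) * Real.sqrt (p z.2 * q z.2)
        * (Real.log (p z.1 / q z.1) - Real.log (p z.2 / q z.2)) ^ 2
      = 2 * bhatt p q * (∑ x, Real.sqrt (p x * q x) * (Real.log (p x / q x) - c) ^ 2)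
        - 2 * (∑ x, Real.sqrt (p x * q x) * (Real.log (p x / q x) - c)) ^ 2 := by
    rw [Fintype.sum_prod_type]
    have e : ∀ x y : X, Real.sqrt (p x * q x) * Real.sqrt (p y * q y)
        * (Real.log (p x / q x) - Real.log (p y / q y)) ^ 2
        = Real.sqrt (p x * q x) * (Real.log (p x / q x) - c) ^ 2 * Real.sqrt (p y * q y)
          - 2 * ((Real.sqrt (p x * q x) * (Real.log (p x / q x) - c))
            * (Real.sqrt (p y * q y) * (Real.log (p y / q y) - c)))
          + Real.sqrt (p x * q x) * (Real.sqrt (p y * q y) * (Real.log (p y / q y) - c) ^ 2) := by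
      intro x y; ring
    simp only
    simp_rw [e, sum_add_distrib, sum_sub_distrib, ← mul_sum, ← sum_mul]
    unfold bhatt
    ring
  rw [hZ, hV] at hCS
  -- hence `I ≤ 2·BC²·√(γ/(2·BC))`
  have ht0 : 0 ≤ 2 * bhatt p q ^ 2 * Real.sqrt ((∑ x, Real.sqrt (p x * q x)
      * (Real.log (p x / q x) - c) ^ 2) / (2 * bhatt p q)) := by positivity
  have hIle : I ≤ 2 * bhatt p q ^ 2 * Real.sqrt ((∑ x, Real.sqrt (p x * q x)
      * (Real.log (p x / q x) - c) ^ 2) / (2 * bhatt p q)) := by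
    rw [← sq_le_sq₀ hI0 ht0, mul_pow, Real.sq_sqrt (by positivity)]
    have e2 : (2 * bhatt p q ^ 2) ^ 2 * ((∑ x, Real.sqrt (p x * q x)
        * (Real.log (p x / q x) - c) ^ 2) / (2 * bhatt p q))
        = bhatt p q ^ 2 * (2 * bhatt p q * ∑ x, Real.sqrt (p x * q x)
          * (Real.log (p x / q x) - c) ^ 2) := by
      field_simp
    rw [e2]
    nlinarith [hCS, sq_nonneg (∑ x, Real.sqrt (p x * q x) * (Real.log (p x / q x) - c)),
      sq_nonneg (bhatt p q)]
  have hfloor := bhatt_sq_mul_exp_le_accRate hp hq hB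
  rw [hIxy] at hfloor
  refine le_trans (mul_le_mul_of_nonneg_left (Real.exp_le_exp.2 ?_) (sq_nonneg _)) hfloor
  rw [neg_div, neg_le_neg_iff, div_le_iff₀ (by positivity)]
  linarith [hIle]

/-- **THE JENSEN FLOOR FOR A BOUNDED LOG WEIGHT (finite).**  If `|log(p_x/q_x) − c| ≤ R` wherever
`p_x q_x > 0` then `bhatt p q ²·e^{−R/√2} ≤ accRate p q`. [ours] -/
theorem bhatt_sq_mul_exp_le_accRate_of_abs_le {p q : X → ℝ} (hp : ∀ x, 0 ≤ p x) (hq : ∀ x, 0 ≤ q x)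
    (hB : 0 < bhatt p q) {c R : ℝ} (hR : 0 ≤ R)
    (hbd : ∀ x, 0 < p x → 0 < q x → |Real.log (p x / q x) - c| ≤ R) :
    bhatt p q ^ 2 * Real.exp (-(R / Real.sqrt 2)) ≤ accRate p q := by
  set B := bhatt p q with hBdef
  have hk0 : ∀ x, 0 ≤ Real.sqrt (p x * q x) := fun x => Real.sqrt_nonneg _
  have hpt : ∀ x, Real.sqrt (p x * q x) * (Real.log (p x / q x) - c) ^ 2
      ≤ Real.sqrt (p x * q x) * R ^ 2 := by
    intro x
    rcases (hp x).eq_or_lt with hpx | hpx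
    · rw [← hpx, zero_mul, Real.sqrt_zero, zero_mul, zero_mul]
    rcases (hq x).eq_or_lt with hqx | hqx
    · rw [← hqx, mul_zero, Real.sqrt_zero, zero_mul, zero_mul]
    refine mul_le_mul_of_nonneg_left ?_ (hk0 x)
    rw [← sq_abs]
    exact pow_le_pow_left₀ (abs_nonneg _) (hbd x hpx hqx) 2
  have hγ : ∑ x, Real.sqrt (p x * q x) * (Real.log (p x / q x) - c) ^ 2 ≤ B * R ^ 2 := by
    calc ∑ x, Real.sqrt (p x * q x) * (Real.log (p x / q x) - c) ^ 2
        ≤ ∑ x, Real.sqrt (p x * q x) * R ^ 2 := sum_le_sum fun x _ => hpt x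
      _ = B * R ^ 2 := by rw [← sum_mul]; rfl
  have hfloor := bhatt_sq_mul_exp_sqrt_le_accRate hp hq hB c
  refine le_trans (mul_le_mul_of_nonneg_left (Real.exp_le_exp.2 ?_) (sq_nonneg _)) hfloor
  rw [neg_le_neg_iff]
  have hs : Real.sqrt ((∑ x, Real.sqrt (p x * q x) * (Real.log (p x / q x) - c) ^ 2) / (2 * B))
      ≤ Real.sqrt (R ^ 2 / 2) := by
    refine Real.sqrt_le_sqrt ?_
    rw [div_le_div_iff₀ (by positivity) (by norm_num)]
    nlinarith
  rw [Real.sqrt_div (sq_nonneg R), Real.sqrt_sq hR] at hs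
  exact hs

end Summit.Ventures.LatticeQCDFlow.Theory2
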